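import Literature.Claims.NS.ClayVariants
import Literature.Analysis.FluidPDE.ClassicalSolution
import Literature.Analysis.FluidPDE.CurlFreeLiouville
import Literature.Analysis.FluidPDE.LambFormCurlKernel
import Literature.Analysis.FluidPDE.ForcingSymmetry
import Literature.Analysis.FluidPDE.SteadyStrainedNS
import Literature.Analysis.FluidPDE.VorticityCalculus
import Literature.Analysis.FluidPDE.VorticityEquation
import Literature.Analysis.FluidPDE.PolygonCirculation
import Literature.Analysis.FluidPDE.PressureReconstruction
import Literature.Analysis.FunctionSpaces.SmoothParametricSetIntegral
import Mathlib.Analysis.Calculus.BumpFunction.Normed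
import HarnessLib

/-!
# Claim skeleton: Lo (2008), «Smooth Solutions of the Three Dimensional Navier-Stokes Problem»
# (arXiv:0803.1034v3 [math-ph])

Cell `ns-claims` (D-0090 NS-CLAIMS SWEEP), claim C45, typist `ns-claims-typist-5`. UNREFEREED arXiv
ITEM under adjudication — NOTHING in this file asserts a step: every `Step_k` is a `Prop`; the only
`theorem`s are the composition `claim_of_steps` (a real proof: the five printed steps DO compose to
the printed Proposition), `exists_isUnitBump` (a bump function with unit mass exists — the proof's
«Let h be a smooth function with compact support satisfying ∫h = 1»), and — rev 2 — `clayOverlapTrivial_holds`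
(the Clay delta Δ4 in the kernel: a Clay (A) datum in the Proposition's class is `≡ 0`).
Rev 3 (typist-5 g3, kit-pool pairing with the C45 refuter): `step_1_holds`, `step_2_holds` and
`claimedTheorem_holds` — printed Steps 1–2 and **Proposition 1 itself HOLD in the tree** (for a
smooth divergence- and curl-free datum the STEADY pair `u(t) = u⁰`, `p = V − ½|u⁰|²` is a classical
solution on all of `ℝ` for every `ν`: `Δu⁰ = 0` by `FluidPDE.laplacian_eq_zero_of_curl_eq_zero_of_isDivFree`,
`(u⁰·∇)u⁰ = ∇½|u⁰|²` by the Lamb form `FluidPDE.convect_self_eq_cross_curl_add_gradient`, the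
conservative force absorbed by `IsClassicalNSSolutionOn.add_gradient_force`). So the row reads, in
the kernel: the printed proof composes (`claim_of_steps`), the printed Proposition is true
(`claimedTheorem_holds`), and its data class meets Clay (A)'s in `u⁰ ≡ 0` only
(`clayOverlapTrivial_holds`) — the locator is the STATEMENT (Δ4/Δ5), not a step.

Version of record (pinned by ns-claims-lit-3): A. Lo (KFUPM), arXiv:0803.1034 **v3** (13 May 2008)
[Lo2008] (listing title «On the Solutions of the Three Dimensional Navier-Stokes Problem»; v1 7 Mar
2008); TeX `pub/ns-claims/sources/Lo2008/arXiv-0803.1034v3-TeX_PINNED/Navier-Solution-Man.tex` (275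
lines; LOCATORS = TeX lines `l.NNN`), PDF `sources/Lo2008/arXiv-PDF/0803.1034v3.pdf` (4 pp.; print
page = PDF page, PAGEMAP.md by ns-claims-lit-1: Proposition 1 and its whole proof p.2, Corollary p.3,
§3 Proposition 2 pp.3–4, Conclusion p.4). LOCATORS.md by ns-claims-lit-3 (T3 stub).

## Claimed statement (as printed)

Abstract l.48–55 (p.1): «The aim of this paper is to solve the three dimensional Navier-Stokes
problem with conservative source term when the initial conditions are divergence and curl free. We
use convolution methods with basic vector calculus to construct "well behaved" smooth solutions of
the initial boundary value problem for the system of Navier-Stokes.» **Proposition 1, l.101–121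
(p.2)**: «Let u⁰(x) be a smooth vector field in ℝ³ satisfying div u⁰(x) = curl u⁰(x) = 0. If f is a
conservative force, then there exist u(x,t), p(x,t) ∈ C^∞(ℝ³ × ℝ) with u(x,0) = u⁰(x) solutions of
the Navier-Stokes equation ∂u/∂t − νΔu + (u·∇)u + ∇p = f, div u = 0.» Conclusion l.249–255 (p.4):
«The results above guarantee the existence of smooth solutions to the three dimensional Navier-Stoke
problem. A fundamental problem in analysis is to decide whether a smooth, physically reasonable
solutions in the sense of [1] exist for the Navier–Stokes equations. We believed that we have given
a partial answer to the question by constructing solutions that behave well in the two variables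
with initial conditions that are both divergence and curl free.» ([1] = Fefferman's Clay text.)
Direction: global smooth EXISTENCE for the RESTRICTED data class {div u⁰ = curl u⁰ = 0} (harmonic
gradients) with conservative forcing, on ℝ³, all `t ∈ ℝ`. Typed as printed: `ClaimedTheorem`
(NOT Clay (A); the author himself says «partial answer»).

## Clay delta (reference `ClayVariants.lean`) — «WRONG PROBLEM» CANDIDATE AT THE STATEMENT

Nearest: (A) `ClayVariants.clayR3.Regularity`. Not schema-shaped, so no `clay_of_claimed`
(CLAYVARIANTS-USAGE «not schema-shaped: record the axis»): (Δ4 DATA) the Proposition covers only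
data with `div u⁰ = 0` AND `curl u⁰ = 0`, i.e. `u⁰ = ∇φ` with `φ` harmonic on ℝ³ — under the Clay
decay (4) the only such datum is `u⁰ ≡ 0` (each component of `u⁰` is then a harmonic function
tending to `0` at infinity, hence vanishes: Liouville), recorded as the Prop
`ClayOverlapTrivial` below (TRUE, a salvage target — it says the Proposition's class meets Clay (A)'s
in the zero datum only); (Δ5 ADMISSIBILITY) no energy bound (7): a nonzero potential flow on ℝ³ has
infinite energy, and the constructed `u(·,t) = ∫ u⁰(· − ty) h(y) dy` is again a harmonic gradient;
(Δ3 FORCE) conservative `f` — MORE general than (A)'s `f ≡ 0` on this axis, no obstruction;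
(Δ7) all `t ∈ ℝ` — stronger. The printed Proposition is classical and TRUE (irrotational
incompressible smooth families are exact Navier–Stokes solutions once the pressure absorbs
`∂ₜu + ∇½|u|²`, cf. the tree's Serrin potential flows `FluidPDE.serrin_potentialFlow_isClassical`);
the five printed steps are each true and `claim_of_steps` is PROVED — so the row is expected to read
«discharges as printed; wrong problem (Δ4 + Δ5) against (A)» (C03c pattern), the chair's call.

## Steps (ordered index; Proposition 1's proof, l.123–165, p.2)

* Step 1 = `Step_1` — l.123–124 «Without loss of generality, we may assume that f = 0» (a
  conservative force is absorbed into the pressure). Flag: true.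
* Step 2 = `Step_2` — l.124–128 «First observe that (u·∇)u = ∇(½|u|²) − u × curl u». Flag: true
  (Lamb form; tree `FluidPDE.convect_self_eq_cross_curl_add_gradient`).
* Step 3 = `Step_3` — l.140–151: «Let h be a smooth function with compact support satisfying
  ∫_{ℝ³} h(x)dx = 1. Let u(x,t) = ∫_{ℝ³} u⁰(x − ty)h(y)dy. u(x,t) is C^∞ in {(x,t) ∈ ℝ^{3+1}: t ≠ 0},
  satisfies u(x,0) = u⁰(x). Moreover, we have div u = 0 and curl u = 0.» Typed with joint
  smoothness on ALL of ℝ³ × ℝ (what the Proposition's conclusion «C^∞(ℝ³ × ℝ)» needs and what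
  differentiation under the integral gives for smooth u⁰; the print only says `t ≠ 0`). Flag: true.
* Step 4 = `Step_4` — l.151–156 «This implies that curl[∂u/∂t − νΔu + ∇(½|u|²) − u × curl u] = 0.»
  Flag: true.
* Step 5 = `Step_5` — l.157–164 «Hence, the vector field ∂u/∂t − νΔu + ∇(½|u|²) − u × curl u is
  conservative for all t. Therefore equation (1.1) is satisfied for some p(x,t) ∈ C^∞(ℝ^{3+1}).»
  (Poincaré lemma on ℝ³ with smooth dependence on `t`.) Flag: true.
Not typed: the Corollary l.178–197, p.3 (data `u⁰ = ∇g`, `g` a solution of `g ∗ h = g` in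
`L¹(ℝ³, e^{−2π|x|}dx)`, harmonic by Natan–Weit [4] — an instance of Proposition 1 once `g` is smooth
harmonic; the cited characterisation is not typed); §3 Proposition 2 l.204–245 (pp.3–4: the same
construction on `u⁰ = ∇g`, `g(x,y,z) = (φ ∗ Ψ(ζ·))(z)·cos(αx + βy)`, `ζ² = α² + β²`, `Ψ″ = Ψ` —
harmonic, periodic in `x, y`, growth `e^{ζ|z|}` in `z`: an instance of Proposition 1; neither
ℤ³-periodic (Clay (8)) nor of bounded energy — Δ4/Δ5 again).

## COMPOSITION — PROVED (`claim_of_steps`)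

`Step_1 → Step_2 → Step_3 → Step_4 → Step_5 → ClaimedTheorem`, assembling the printed proof: the
bump `h` from `exists_isUnitBump`, `u` from Step 3, the pressure from Step 5 applied to the bracket
of Step 4, the momentum equation via Step 2 with `curl u = 0`, and the conservative force put back
by Step 1.

WHAT THIS IS NOT: not a claim about NS regularity or blow-up; not a claim about any author beyond the
typed locator.
-/

open MeasureTheory Set Filter Function
open scoped ContDiff Topology Laplacian InnerProductSpace

namespace Literature.Claims.NS.Lo2008

open Literature.Analysis.FluidPDE

noncomputable section

/-! ## Vocabulary (definitions with bodies; nothing asserted) -/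

/-- `curl v = 0` everywhere («curl u⁰(x) = 0», Proposition 1, l.104–107). [cite: Lo2008, Proposition 1, l.101–121 (p.2)] -/
def IsCurlFree (v : EuclideanSpace ℝ (Fin 3) → EuclideanSpace ℝ (Fin 3)) : Prop :=
  ∀ x, curl v x = 0

/-- «f is a conservative force» (l.108): `f(·,t) = ∇V(·,t)` for a potential `V` jointly smooth on
`ℝ³ × ℝ` (the paper does not spell the regularity of `f`; smoothness is what «p ∈ C^∞(ℝ³ × ℝ)» in
the conclusion requires once `f` is absorbed into the pressure, l.123–124).
[cite: Lo2008, Proposition 1, l.108 (p.2)] -/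
def IsConservative (f : ℝ → EuclideanSpace ℝ (Fin 3) → EuclideanSpace ℝ (Fin 3)) : Prop :=
  ∃ V : ℝ → EuclideanSpace ℝ (Fin 3) → ℝ,
    IsSmoothSpaceTimeOn univ V ∧ ∀ t x, f t x = gradient (V t) x

/-- «Let h be a smooth function with compact support satisfying ∫_{ℝ³} h(x) dx = 1» (l.140–143).
[cite: Lo2008, proof of Proposition 1, l.140–143 (p.2)] -/
def IsUnitBump (h : EuclideanSpace ℝ (Fin 3) → ℝ) : Prop :=
  ContDiff ℝ ∞ h ∧ HasCompactSupport h ∧ ∫ y, h y = 1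

/-- The paper's solution formula (l.144–147): `u(x,t) = ∫_{ℝ³} u⁰(x − t y) h(y) dy` (a dilated
average of the datum; at `t = 0` it returns `u⁰(x)·∫h = u⁰(x)`).
[cite: Lo2008, proof of Proposition 1, l.144–147 (p.2)] -/
def dilatedAverage (u₀ : EuclideanSpace ℝ (Fin 3) → EuclideanSpace ℝ (Fin 3))
    (h : EuclideanSpace ℝ (Fin 3) → ℝ) (t : ℝ) (x : EuclideanSpace ℝ (Fin 3)) :
    EuclideanSpace ℝ (Fin 3) :=
  ∫ y, h y • u₀ (x - t • y)

/-- The bracket of l.153–161: `∂u/∂t − νΔu + ∇(½|u|²) − u × curl u` (time derivative on all of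
`ℝ`, the tree's `timeDerivWithin univ`; `cross`/`curl` of `FluidPDE.VectorCalculus`).
[cite: Lo2008, proof of Proposition 1, l.151–161 (p.2)] -/
def bracket (ν : ℝ) (u : ℝ → EuclideanSpace ℝ (Fin 3) → EuclideanSpace ℝ (Fin 3)) (t : ℝ)
    (x : EuclideanSpace ℝ (Fin 3)) : EuclideanSpace ℝ (Fin 3) :=
  timeDerivWithin univ u t x - ν • (Δ (u t)) x + gradient (fun y => ‖u t y‖ ^ 2 / 2) x -
    cross (u t x) (curl (u t) x)

/-- A smooth compactly supported `h` with `∫h = 1` exists (Mathlib's normed bump function), so the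
proof's «Let h be …» (l.140) is not an extra hypothesis. [cite: Lo2008, proof of Proposition 1, l.140–143 (p.2)] -/
theorem exists_isUnitBump : ∃ h : EuclideanSpace ℝ (Fin 3) → ℝ, IsUnitBump h := by
  let φ : ContDiffBump (0 : EuclideanSpace ℝ (Fin 3)) := ⟨1, 2, one_pos, one_lt_two⟩
  exact ⟨φ.normed volume, φ.contDiff_normed, φ.hasCompactSupport_normed, φ.integral_normed⟩

/-! ## The claimed statement -/

/-- **Proposition 1 as printed (l.101–121, p.2)**: «Let u⁰(x) be a smooth vector field in ℝ³
satisfying div u⁰(x) = curl u⁰(x) = 0. If f is a conservative force, then there exist u(x,t),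
p(x,t) ∈ C^∞(ℝ³ × ℝ) with u(x,0) = u⁰(x) solutions of the Navier-Stokes equation.» Typed over the
tree's classical-solution predicate on the whole time line `univ` («C^∞(ℝ³ × ℝ)»), for every
viscosity `ν > 0` («The viscosity ν is assumed to be constant», l.92). NOT Clay (A): data class
Δ4 (harmonic gradients), no energy bound Δ5 — see `ClayOverlapTrivial` and the module docstring.
[cite: Lo2008, Proposition 1, l.101–121 (p.2)] -/
def ClaimedTheorem : Prop :=
  ∀ ν : ℝ, 0 < ν →
    ∀ u₀ : EuclideanSpace ℝ (Fin 3) → EuclideanSpace ℝ (Fin 3), ContDiff ℝ ∞ u₀ →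
      VectorCalculus.IsDivFree u₀ → IsCurlFree u₀ →
      ∀ f : ℝ → EuclideanSpace ℝ (Fin 3) → EuclideanSpace ℝ (Fin 3), IsConservative f →
        ∃ (u : ℝ → EuclideanSpace ℝ (Fin 3) → EuclideanSpace ℝ (Fin 3))
          (p : ℝ → EuclideanSpace ℝ (Fin 3) → ℝ),
          IsClassicalNSSolutionOn univ ν f u p ∧ u 0 = u₀

/-- **The typed Clay delta (Δ4), as the statement a salvage seat can prove**: a smooth
divergence-free AND curl-free field with Fefferman's decay (4) vanishes identically (each component
is harmonic and tends to zero) — the Proposition's data class meets the Clay (A) data class in the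
zero datum only. Not a step of the paper; recorded so that a «wrong problem (Δ4)» verdict has a
kernel object to point at. [cite: Lo2008, Proposition 1 (p.2) with Conclusion l.249–255 (p.4)] -/
def ClayOverlapTrivial : Prop :=
  ∀ u₀ : EuclideanSpace ℝ (Fin 3) → EuclideanSpace ℝ (Fin 3), ContDiff ℝ ∞ u₀ →
    VectorCalculus.IsDivFree u₀ → IsCurlFree u₀ → HasRapidSpatialDecay u₀ → u₀ = 0

/-! ## The steps -/

/-- **Step 1 — l.123–124 (p.2)**: «Without loss of generality, we may assume that f = 0.» Typed: a
classical solution with zero force and pressure `p` is a classical solution with the conservative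
force `∇V` and pressure `p + V` (jointly smooth potential `V`). Flag: true.
[cite: Lo2008, proof of Proposition 1, l.123–124 (p.2)] -/
def Step_1 : Prop :=
  ∀ (ν : ℝ) (u : ℝ → EuclideanSpace ℝ (Fin 3) → EuclideanSpace ℝ (Fin 3))
    (p V : ℝ → EuclideanSpace ℝ (Fin 3) → ℝ),
    IsSmoothSpaceTimeOn univ V → IsClassicalNSSolutionOn univ ν 0 u p →
      IsClassicalNSSolutionOn univ ν (fun t x => gradient (V t) x) u (fun t x => p t x + V t x)

/-- **Step 2 — l.124–128 (p.2)**: «First observe that (u·∇)u = ∇(½|u|²) − u × curl u» (for a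
differentiable field on ℝ³). Flag: true (Lamb form). [cite: Lo2008, proof of Proposition 1, l.124–128 (p.2)] -/
def Step_2 : Prop :=
  ∀ v : EuclideanSpace ℝ (Fin 3) → EuclideanSpace ℝ (Fin 3), Differentiable ℝ v →
    ∀ x, convect v v x = gradient (fun y => ‖v y‖ ^ 2 / 2) x - cross (v x) (curl v x)

/-- **Step 3 — the construction, l.140–151 (p.2)**: «Let u(x,t) = ∫_{ℝ³} u⁰(x − ty)h(y)dy. u(x,t)
is C^∞ in {(x,t) ∈ ℝ^{3+1}: t ≠ 0}, satisfies u(x,0) = u⁰(x). Moreover, we have div u = 0 and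
curl u = 0.» Typed for every smooth divergence- and curl-free `u⁰` and every unit bump `h`, with
joint smoothness on all of `ℝ³ × ℝ` (the print states it for `t ≠ 0`; the Proposition's conclusion
«u ∈ C^∞(ℝ³ × ℝ)» needs, and differentiation under the integral gives, all `t`). Flag: true.
[cite: Lo2008, proof of Proposition 1, l.140–151 (p.2)] -/
def Step_3 : Prop :=
  ∀ u₀ : EuclideanSpace ℝ (Fin 3) → EuclideanSpace ℝ (Fin 3), ContDiff ℝ ∞ u₀ →
    VectorCalculus.IsDivFree u₀ → IsCurlFree u₀ →
    ∀ h : EuclideanSpace ℝ (Fin 3) → ℝ, IsUnitBump h →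
      IsSmoothSpaceTimeOn univ (dilatedAverage u₀ h) ∧ dilatedAverage u₀ h 0 = u₀ ∧
        ∀ t : ℝ, VectorCalculus.IsDivFree (dilatedAverage u₀ h t) ∧
          IsCurlFree (dilatedAverage u₀ h t)

/-- **Step 4 — l.151–156 (p.2)**: «This implies that curl[∂u/∂t − νΔu + ∇(½|u|²) − u × curl u]
= 0» — for a jointly smooth family with curl-free time slices. Flag: true.
[cite: Lo2008, proof of Proposition 1, l.151–156 (p.2)] -/
def Step_4 : Prop :=
  ∀ (ν : ℝ) (u : ℝ → EuclideanSpace ℝ (Fin 3) → EuclideanSpace ℝ (Fin 3)),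
    IsSmoothSpaceTimeOn univ u → (∀ t, IsCurlFree (u t)) → ∀ t, IsCurlFree (bracket ν u t)

/-- **Step 5 — l.157–164 (p.2)**: «Hence, the vector field ∂u/∂t − νΔu + ∇(½|u|²) − u × curl u
is conservative for all t. Therefore equation (1.1) is satisfied for some p(x,t) ∈ C^∞(ℝ^{3+1}).»
Typed: for a jointly smooth curl-free family whose bracket is curl-free at every time there is a
jointly smooth `p` with `bracket + ∇p = 0` (Poincaré lemma on ℝ³, smoothly in `t`). Flag: true.
[cite: Lo2008, proof of Proposition 1, l.157–164 (p.2)] -/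
def Step_5 : Prop :=
  ∀ (ν : ℝ) (u : ℝ → EuclideanSpace ℝ (Fin 3) → EuclideanSpace ℝ (Fin 3)),
    IsSmoothSpaceTimeOn univ u → (∀ t, IsCurlFree (u t)) → (∀ t, IsCurlFree (bracket ν u t)) →
      ∃ p : ℝ → EuclideanSpace ℝ (Fin 3) → ℝ,
        IsSmoothSpaceTimeOn univ p ∧ ∀ t x, bracket ν u t x + gradient (p t) x = 0

/-! ## Composition — PROVED -/

/-- **COMPOSITION (the printed proof, l.123–165, assembles)**: Steps 1–5 give Proposition 1.
[cite: Lo2008, proof of Proposition 1, l.123–165 (p.2)] -/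
theorem claim_of_steps (h1 : Step_1) (h2 : Step_2) (h3 : Step_3) (h4 : Step_4) (h5 : Step_5) :
    ClaimedTheorem := by
  intro ν _hν u₀ hu₀ hdiv hcurl f hf
  obtain ⟨V, hV, hfV⟩ := hf
  obtain ⟨h, hh⟩ := exists_isUnitBump
  obtain ⟨hsm, h0, hdc⟩ := h3 u₀ hu₀ hdiv hcurl h hh
  have hcf : ∀ t, IsCurlFree (dilatedAverage u₀ h t) := fun t => (hdc t).2
  obtain ⟨p, hp, hpeq⟩ := h5 ν (dilatedAverage u₀ h) hsm hcf (h4 ν _ hsm hcf)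
  have hsol0 : IsClassicalNSSolutionOn univ ν 0 (dilatedAverage u₀ h) p := by
    refine ⟨hsm, hp, ?_, fun t _ => (hdc t).1⟩
    intro t _ x
    have hdiff : Differentiable ℝ (dilatedAverage u₀ h t) :=
      (hsm.contDiff_slice (mem_univ t)).differentiable (by simp)
    have hlamb := h2 (dilatedAverage u₀ h t) hdiff x
    have hc0 : curl (dilatedAverage u₀ h t) x = 0 := hcf t x
    have hx0 : cross (dilatedAverage u₀ h t x) 0 = 0 := by simp [cross]
    have hb := hpeq t x
    simp only [bracket, hc0, hx0, sub_zero] at hb hlamb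
    rw [hlamb, Pi.zero_apply, Pi.zero_apply, add_zero]
    -- hb : ∂ₜu − νΔu + ∇(½|u|²) + ∇p = 0 ;  goal : ∂ₜu + ∇(½|u|²) = νΔu − ∇p
    have hb' : timeDerivWithin univ (dilatedAverage u₀ h) t x +
        gradient (fun y => ‖dilatedAverage u₀ h t y‖ ^ 2 / 2) x + gradient (p t) x -
        ν • (Δ (dilatedAverage u₀ h t)) x = 0 := by
      rw [← hb]; abel
    rw [sub_eq_zero] at hb'
    rw [eq_sub_iff_add_eq, hb']
  refine ⟨dilatedAverage u₀ h, fun t x => p t x + V t x, ?_, h0⟩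
  have hfeq : f = fun t x => gradient (V t) x := funext fun t => funext fun x => hfV t x
  rw [hfeq]
  exact h1 ν _ p V hV hsol0

/-- **The Clay delta Δ4 holds in the kernel** (rev 2): a smooth divergence-free, curl-free field with
Fefferman's decay (4) vanishes identically. Decay (4) with `n = 0, K = 0` bounds the field, so it is
constant by the tree's Liouville theorem for bounded irrotational incompressible fields
(`eq_of_curl_eq_zero_of_isDivFree_of_bounded`: each component is a bounded harmonic function), and
decay with `n = 0, K = 1` kills a nonzero constant. Hence Proposition 1 restricted to Clay (A) data
speaks about the zero datum only. [cite: Lo2008, Proposition 1 (p.2) with Conclusion l.249–255 (p.4); FeffermanClay2006, (4) p.1] -/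
theorem clayOverlapTrivial_holds : ClayOverlapTrivial := by
  intro u₀ hu₀ hdiv hcurl hdec
  -- (4) with n = 0, K = 0: `u₀` is bounded
  obtain ⟨M, hM⟩ := hdec 0 0
  have hbdd : ∀ x, ‖u₀ x‖ ≤ M := fun x => by
    simpa [norm_iteratedFDeriv_zero] using hM x
  -- Liouville: `u₀` is constant
  have hconst : ∀ x, u₀ x = u₀ 0 := fun x =>
    eq_of_curl_eq_zero_of_isDivFree_of_bounded (hu₀.of_le (by norm_cast)) hcurl hdiv hbdd x 0
  -- (4) with n = 0, K = 1: the constant is zero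
  set c := u₀ 0 with hc
  suffices h0 : c = 0 by
    funext x; rw [hconst x, h0]; rfl
  by_contra hne
  obtain ⟨C, hC⟩ := hdec 0 1
  have hpos : 0 < ‖c‖ := norm_pos_iff.mpr hne
  set R : ℝ := max C 0 / ‖c‖ + 1 with hR
  have hRpos : 0 < R := by
    have : 0 ≤ max C 0 / ‖c‖ := div_nonneg (le_max_right _ _) hpos.le
    linarith
  have hx := hC (R • EuclideanSpace.single 0 (1 : ℝ))
  have hn : ‖(EuclideanSpace.single 0 (1 : ℝ) : EuclideanSpace ℝ (Fin 3))‖ = 1 := by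
    simp [EuclideanSpace.single, PiLp.norm_single]
  rw [pow_one, norm_iteratedFDeriv_zero, hconst, norm_smul, hn, mul_one,
    Real.norm_of_nonneg hRpos.le] at hx
  have h1 : (1 + R) * ‖c‖ ≤ max C 0 := hx.trans (le_max_left _ _)
  have h2 : R * ‖c‖ = max C 0 + ‖c‖ := by
    rw [hR, add_mul, one_mul, div_mul_cancel₀ _ hpos.ne']
  nlinarith


/-! ## Rev 3 — printed Steps 1–2 and Proposition 1 itself hold in the tree (nothing above changed) -/

/-- `0 × v = 0` for the tree's cross product (componentwise). [folklore] -/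
private theorem cross_zero_left' (v : EuclideanSpace ℝ (Fin 3)) : cross 0 v = 0 := by
  simp [cross]

open scoped Matrix in
/-- Antisymmetry of the tree's cross product, `a × b = −(b × a)` (Mathlib `neg_cross` transported
along `toLp`/`ofLp`). [folklore] -/
private theorem cross_anticomm' (a b : EuclideanSpace ℝ (Fin 3)) : cross a b = -cross b a := by
  show WithLp.toLp 2 (WithLp.ofLp a ⨯₃ WithLp.ofLp b) = -WithLp.toLp 2 (WithLp.ofLp b ⨯₃ WithLp.ofLp a)
  rw [← neg_cross (WithLp.ofLp b) (WithLp.ofLp a), WithLp.toLp_neg]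

/-- **Step 1 holds** (l.123–124 «we may assume that f = 0»): a classical solution with zero force
and pressure `p` is a classical solution with the conservative force `∇V` and pressure `p + V` —
the tree's forcing symmetry `IsClassicalNSSolutionOn.add_gradient_force` (Tao 2013 §3).
[cite: Lo2008, proof of Proposition 1, l.123–124 (p.2)] -/
theorem step_1_holds : Step_1 := by
  intro ν u p V hV hsol
  refine (hsol.add_gradient_force hV).congr_force fun t _ x => ?_
  simp

/-- **Step 2 holds** (l.124–128, the Lamb form «(u·∇)u = ∇(½|u|²) − u × curl u»): the tree's
`FluidPDE.convect_self_eq_cross_curl_add_gradient` (`(v·∇)v = curl v × v + ∇½|v|²`) and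
`u × curl u = −(curl u × u)`. [cite: Lo2008, proof of Proposition 1, l.124–128 (p.2)] -/
theorem step_2_holds : Step_2 := by
  intro v hv x
  rw [convect_self_eq_cross_curl_add_gradient (hv x), cross_anticomm' (v x) (curl v x)]
  abel

/-- **Proposition 1 as printed HOLDS** (l.101–121, p.2) — independently of the printed
construction: for a smooth datum `u⁰` with `div u⁰ = curl u⁰ = 0` and a conservative force
`f = ∇V`, the steady pair `u(t) = u⁰`, `p(t) = V(t) − ½|u⁰|²` is a classical Navier–Stokes solution
on the whole time line for every `ν > 0`, with `u(0) = u⁰`: `u⁰` is harmonic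
(`laplacian_eq_zero_of_curl_eq_zero_of_isDivFree`), `(u⁰·∇)u⁰ = ∇½|u⁰|²` (Lamb form with
`curl u⁰ = 0`), so `∂ₜu + (u·∇)u = 0 + ∇½|u⁰|² = νΔu − ∇p + f`. Hence the C45 row's kernel reading:
the printed Proposition is TRUE and its proof composes (`claim_of_steps`); against Clay (A) the
locator is the STATEMENT — data class Δ4 (`clayOverlapTrivial_holds`: Clay data in the class are
`≡ 0`) and no energy bound Δ5 (a nonzero harmonic gradient is not in `L²`; not typed).
[cite: Lo2008, Proposition 1, l.101–121 (p.2); Conclusion l.249–255 (p.4)] -/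
theorem claimedTheorem_holds : ClaimedTheorem := by
  intro ν _hν u₀ hu₀ hdiv hcurl f hf
  obtain ⟨V, hV, hfV⟩ := hf
  have hΔ : ∀ x, (Δ u₀) x = 0 := fun x =>
    laplacian_eq_zero_of_curl_eq_zero_of_isDivFree (hu₀.of_le (by norm_cast)) hcurl hdiv x
  -- the steady pair `(u⁰, −½|u⁰|²)` solves the unforced system
  have hsteady : IsSteadyClassicalNS ν 0 u₀ (fun y => -(‖u₀ y‖ ^ 2 / 2)) := by
    refine ⟨hu₀, ((hu₀.norm_sq ℝ).div_const 2).neg, fun x => ?_, hdiv⟩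
    have hdx : DifferentiableAt ℝ u₀ x := (hu₀.differentiable (by simp)) x
    have hneg : gradient (fun y => -(‖u₀ y‖ ^ 2 / 2)) x = -gradient (fun y => ‖u₀ y‖ ^ 2 / 2) x := by
      simp only [gradient, fderiv_fun_neg, map_neg]
    rw [convect_self_eq_cross_curl_add_gradient hdx, hcurl x, cross_zero_left', zero_add, hΔ x,
      smul_zero, zero_sub, hneg, neg_neg, Pi.zero_apply, add_zero]
  have hsol0 : IsClassicalNSSolutionOn univ ν (fun _ => (0 : EuclideanSpace ℝ (Fin 3) →
      EuclideanSpace ℝ (Fin 3))) (fun _ => u₀) (fun _ => fun y => -(‖u₀ y‖ ^ 2 / 2)) :=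
    isSteadyClassicalNS_iff_const.1 hsteady
  -- put the conservative force back (forcing symmetry), pressure `V − ½|u⁰|²`
  have hsol : IsClassicalNSSolutionOn univ ν f (fun _ => u₀)
      (fun t y => -(‖u₀ y‖ ^ 2 / 2) + V t y) :=
    (hsol0.add_gradient_force hV).congr_force fun t _ x => by simp [hfV t x]
  exact ⟨fun _ => u₀, fun t y => -(‖u₀ y‖ ^ 2 / 2) + V t y, hsol, rfl⟩

/-! ## Rev 4 — printed Steps 4–5 hold in the tree (typist-5 g5, D-0026 debt pass; nothing above changed)

The two remaining «calculus» steps of the printed proof are discharged from the tree's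
space–time calculus: Step 4 (the bracket of a curl-free smooth family is curl-free) from
`curl ∂ₜ = ∂ₜ curl` (`IsSmoothSpaceTimeOn.curl_timeDerivWithin`, `VorticityEquation`),
`curl Δ = Δ curl` (`curl_laplacian`, `VorticityCalculus`) and `curl ∇ = 0`
(`curl_gradient_eq_zero_holds`, `VectorCalculus`); Step 5 (a curl-free jointly smooth family is
a jointly smooth gradient) from the Poincaré segment potential `q(x) = ∫₀¹ ⟪g(σx), x⟫ dσ`
(`hasGradientAt_segmentIntegral`) and its joint smoothness in `(t, x)`
(`IsSmoothSpaceTimeOn.segmentIntegral`), both `PressureReconstruction`, with the symmetry of the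
Jacobian read off `curl = 0` (`inner_fderiv_comm_of_curl_eq_zero`, `PolygonCirculation`). Step 3
(the dilated-average construction) follows below; the row's verdict (#79, wrong problem at the
STATEMENT, Δ4/Δ5) is untouched. -/

/-- For a jointly smooth family with curl-free slices the bracket `∂ₜu − νΔu + ∇½|u|² − u × curl u`
is the curl-free-part expression `∂ₜu − νΔu + ∇½|u|²` (the cross term vanishes identically).
[cite: Lo2008, proof of Proposition 1, l.151–161 (p.2)] -/
private theorem bracket_eq_of_curlFree {ν : ℝ}
    {u : ℝ → EuclideanSpace ℝ (Fin 3) → EuclideanSpace ℝ (Fin 3)} (hcurl : ∀ t, IsCurlFree (u t))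
    (t : ℝ) :
    bracket ν u t = fun x =>
      (timeDerivWithin univ u t x - ν • (Δ (u t)) x) + gradient (fun y => ‖u t y‖ ^ 2 / 2) x := by
  funext x
  simp only [bracket, hcurl t x, cross_anticomm' (u t x) 0, cross_zero_left', neg_zero, sub_zero]

/-- Joint smoothness of the three surviving pieces of the bracket: `∂ₜu`, `x ↦ νΔ(u t) x` and
`∇½|u t|²` are jointly smooth on `ℝ × ℝ³` for a jointly smooth `u` (tree
`IsSmoothSpaceTimeOn.timeDerivWithin/laplacian/gradient`). [folklore] -/
private theorem isSmoothSpaceTimeOn_bracket_pieces {ν : ℝ}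
    {u : ℝ → EuclideanSpace ℝ (Fin 3) → EuclideanSpace ℝ (Fin 3)} (hu : IsSmoothSpaceTimeOn univ u) :
    IsSmoothSpaceTimeOn univ (timeDerivWithin univ u) ∧
      IsSmoothSpaceTimeOn univ (fun t x => ν • (Δ (u t)) x) ∧
        IsSmoothSpaceTimeOn univ (fun t x => gradient (fun y => ‖u t y‖ ^ 2 / 2) x) := by
  have hU : UniqueDiffOn ℝ (univ : Set ℝ) := uniqueDiffOn_univ
  refine ⟨hu.timeDerivWithin hU, (hu.laplacian hU).const_smul ν, ?_⟩
  have hN : IsSmoothSpaceTimeOn univ (fun t y => ‖u t y‖ ^ 2 / 2) := by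
    have h1 : ContDiffOn ℝ ∞ (fun z : ℝ × EuclideanSpace ℝ (Fin 3) => ‖uncurry u z‖ ^ 2 / 2)
        (univ ×ˢ univ) := (hu.norm_sq ℝ).div_const 2
    exact h1
  exact hN.gradient hU

/-- **Step 4 holds** (l.151–156 «This implies that curl[∂u/∂t − νΔu + ∇(½|u|²) − u × curl u] = 0»):
for a jointly smooth family `u` on `ℝ × ℝ³` with `curl u(t) ≡ 0` for every `t`, the bracket is
curl-free at every time — `u × curl u ≡ 0`, `curl ∂ₜu = ∂ₜ curl u = 0`
(`IsSmoothSpaceTimeOn.curl_timeDerivWithin`), `curl Δu = Δ curl u = 0` (`curl_laplacian`) and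
`curl ∇½|u|² = 0` (`curl_gradient_eq_zero_holds`). [cite: Lo2008, proof of Proposition 1, l.151–156 (p.2)] -/
theorem step_4_holds : Step_4 := by
  intro ν u hu hcurl t x
  have hU : UniqueDiffOn ℝ (univ : Set ℝ) := uniqueDiffOn_univ
  obtain ⟨hA, hB, hC⟩ := isSmoothSpaceTimeOn_bracket_pieces (ν := ν) hu
  have hAd : DifferentiableAt ℝ (timeDerivWithin univ u t) x :=
    ((hA.contDiff_slice (mem_univ t)).differentiable (by simp)) x
  have hBd : DifferentiableAt ℝ (fun y => ν • (Δ (u t)) y) x :=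
    ((hB.contDiff_slice (mem_univ t)).differentiable (by simp)) x
  have hCd : DifferentiableAt ℝ (fun y => gradient (fun z => ‖u t z‖ ^ 2 / 2) y) x :=
    ((hC.contDiff_slice (mem_univ t)).differentiable (by simp)) x
  -- the vorticity family vanishes identically
  have hω : vorticity u = fun _ _ => (0 : EuclideanSpace ℝ (Fin 3)) := by
    funext s y; exact hcurl s y
  have hcurl0 : curl (u t) = fun _ => (0 : EuclideanSpace ℝ (Fin 3)) := funext (hcurl t)
  -- `curl ∂ₜu = ∂ₜ curl u = 0`
  have h1 : curl (timeDerivWithin univ u t) x = 0 := by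
    rw [hu.curl_timeDerivWithin hU (by simp) (mem_univ t) x, hω, timeDerivWithin_apply]
    simp
  -- `curl (νΔu) = νΔ(curl u) = 0`
  have h2 : curl (fun y => ν • (Δ (u t)) y) x = 0 := by
    have hu3 : ContDiff ℝ 3 (u t) := (hu.contDiff_slice (mem_univ t)).of_le (by norm_cast)
    have hΔd : DifferentiableAt ℝ (Δ (u t)) x :=
      (((hu.laplacian hU).contDiff_slice (mem_univ t)).differentiable (by simp)) x
    rw [curl_const_smul hΔd, curl_laplacian hu3 x, hcurl0, InnerProductSpace.laplacian_const]
    simp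
  -- `curl ∇½|u|² = 0`
  have h3 : curl (fun y => gradient (fun z => ‖u t z‖ ^ 2 / 2) y) x = 0 := by
    have hθ : ContDiff ℝ 2 (fun z => ‖u t z‖ ^ 2 / 2) :=
      (((hu.contDiff_slice (mem_univ t)).norm_sq ℝ).div_const 2).of_le (by norm_cast)
    exact curl_gradient_eq_zero_holds _ hθ x
  have hABd : DifferentiableAt ℝ (fun y => timeDerivWithin univ u t y - ν • (Δ (u t)) y) x :=
    hAd.sub hBd
  rw [bracket_eq_of_curlFree hcurl t, curl_add hABd hCd, curl_sub hAd hBd, h1, h2, h3]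
  simp

/-- **Step 5 holds** (l.157–164 «Hence, the vector field … is conservative for all t. Therefore
equation (1.1) is satisfied for some p(x,t) ∈ C^∞(ℝ^{3+1})»): for a jointly smooth curl-free
family whose bracket is curl-free at every time, the segment (Poincaré) potential
`p(t, x) = −∫₀¹ ⟪bracket(t, σx), x⟫ dσ` is jointly smooth on `ℝ × ℝ³`
(`IsSmoothSpaceTimeOn.segmentIntegral`) and satisfies `∇p(t) = −bracket(t)`
(`hasGradientAt_segmentIntegral`, the Jacobian of the bracket being symmetric because its curl
vanishes, `inner_fderiv_comm_of_curl_eq_zero`). [cite: Lo2008, proof of Proposition 1, l.157–164 (p.2)] -/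
theorem step_5_holds : Step_5 := by
  intro ν u hu hcurl hbr
  obtain ⟨hA, hB, hC⟩ := isSmoothSpaceTimeOn_bracket_pieces (ν := ν) hu
  -- the curl-free field `G = −bracket`, jointly smooth
  set G : ℝ → EuclideanSpace ℝ (Fin 3) → EuclideanSpace ℝ (Fin 3) :=
    fun t x => -(bracket ν u t x) with hG
  have hGeq : G = fun t x => -((timeDerivWithin univ u t x - ν • (Δ (u t)) x) +
      gradient (fun y => ‖u t y‖ ^ 2 / 2) x) := by
    funext t x
    show -(bracket ν u t x) = _
    rw [bracket_eq_of_curlFree hcurl t]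
  have hGs : IsSmoothSpaceTimeOn univ G := by
    rw [hGeq]
    exact ContDiffOn.neg ((hA.sub hB).add hC)
  refine ⟨fun t x => ∫ σ in (0 : ℝ)..1, ⟪G t (σ • x), x⟫_ℝ, hGs.segmentIntegral isOpen_univ,
    fun t x => ?_⟩
  -- symmetric Jacobian from `curl G(t) = −curl bracket(t) = 0`
  have hsymm : ∀ y v w : EuclideanSpace ℝ (Fin 3),
      ⟪fderiv ℝ (G t) y v, w⟫_ℝ = ⟪fderiv ℝ (G t) y w, v⟫_ℝ := fun y v w => by
    refine inner_fderiv_comm_of_curl_eq_zero ?_ v w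
    change curl (fun z => -(bracket ν u t z)) y = 0
    rw [curl_neg, hbr t y, neg_zero]
  have hg := hasGradientAt_segmentIntegral (hGs.contDiff_slice (mem_univ t)) hsymm x
  rw [hg.gradient, hG]
  simp

/-! ## Rev 4 (continued) — printed Step 3 (the dilated-average construction) holds in the tree (typist-5 g5; nothing above changed)

`u(x,t) = ∫ h(y) u⁰(x − ty) dy` is an integral over the bounded set `tsupport h` of the smooth
integrand `(y, (t, x)) ↦ h(y) u⁰(x − ty)`, so it is jointly smooth on `ℝ × ℝ³`
(`FunctionSpaces.contDiff_parametric_setIntegral`), equals `u⁰ ∫h = u⁰` at `t = 0`, and its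
`x`-derivative is `∫ h(y) Du⁰(x − ty) dy` (`FunctionSpaces.hasFDerivAt_parametric_setIntegral`),
whose trace and curl are the averages of `div u⁰ = 0` and `curl u⁰ = 0`. With Rev 3 every printed
step of Proposition 1 is now kernel-true (`step_1_holds` … `step_5_holds`) and so is the
Proposition (`claimedTheorem_holds`); #79's locator remains the STATEMENT (Δ4/Δ5). -/

section Step3

variable {u₀ : EuclideanSpace ℝ (Fin 3) → EuclideanSpace ℝ (Fin 3)}
  {h : EuclideanSpace ℝ (Fin 3) → ℝ}

/-- The dilated average is an integral over the support of the bump. [folklore] -/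
private theorem dilatedAverage_eq_setIntegral (t : ℝ) (x : EuclideanSpace ℝ (Fin 3)) :
    dilatedAverage u₀ h t x = ∫ y in tsupport h, h y • u₀ (x - t • y) := by
  rw [dilatedAverage, setIntegral_eq_integral_of_forall_compl_eq_zero]
  intro y hy
  rw [image_eq_zero_of_notMem_tsupport hy, zero_smul]

/-- The integrand `(y, (t, x)) ↦ h(y) u⁰(x − ty)` is smooth on `ℝ³ × (ℝ × ℝ³)`. [folklore] -/
private theorem contDiff_dilIntegrand (hu₀ : ContDiff ℝ ∞ u₀) (hh : ContDiff ℝ ∞ h) :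
    ContDiff ℝ ∞ fun q : EuclideanSpace ℝ (Fin 3) × (ℝ × EuclideanSpace ℝ (Fin 3)) =>
      h q.1 • u₀ (q.2.2 - q.2.1 • q.1) :=
  (hh.comp contDiff_fst).smul (hu₀.comp ((contDiff_snd.comp contDiff_snd).sub
    ((contDiff_fst.comp contDiff_snd).smul contDiff_fst)))

/-- The slice integrand `(y, x) ↦ h(y) u⁰(x − ty)` is smooth on `ℝ³ × ℝ³`. [folklore] -/
private theorem contDiff_dilIntegrand_slice (hu₀ : ContDiff ℝ ∞ u₀) (hh : ContDiff ℝ ∞ h) (t : ℝ) :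
    ContDiff ℝ ∞ fun q : EuclideanSpace ℝ (Fin 3) × EuclideanSpace ℝ (Fin 3) =>
      h q.1 • u₀ (q.2 - t • q.1) :=
  (hh.comp contDiff_fst).smul (hu₀.comp (contDiff_snd.sub (contDiff_fst.const_smul t)))

/-- The partial `x`-derivative of the slice integrand: `D_x [h(y) u⁰(x − ty)] v = h(y) Du⁰(x − ty) v`.
[folklore] -/
private theorem fderiv_dilIntegrand_slice_inr (hu₀ : ContDiff ℝ ∞ u₀) (hh : ContDiff ℝ ∞ h) (t : ℝ)
    (y x : EuclideanSpace ℝ (Fin 3)) :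
    (fderiv ℝ (fun q : EuclideanSpace ℝ (Fin 3) × EuclideanSpace ℝ (Fin 3) =>
        h q.1 • u₀ (q.2 - t • q.1)) (y, x)).comp
      (ContinuousLinearMap.inr ℝ (EuclideanSpace ℝ (Fin 3)) (EuclideanSpace ℝ (Fin 3))) =
      h y • fderiv ℝ u₀ (x - t • y) := by
  have h1 : HasFDerivAt (fun q : EuclideanSpace ℝ (Fin 3) × EuclideanSpace ℝ (Fin 3) => h q.1)
      ((fderiv ℝ h y).comp (ContinuousLinearMap.fst ℝ _ _)) (y, x) :=
    ((hh.differentiable (by simp)) y).hasFDerivAt.comp _ hasFDerivAt_fst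
  have h2' : HasFDerivAt (fun q : EuclideanSpace ℝ (Fin 3) × EuclideanSpace ℝ (Fin 3) =>
      q.2 - t • q.1) (ContinuousLinearMap.snd ℝ _ _ - t • ContinuousLinearMap.fst ℝ _ _) (y, x) :=
    hasFDerivAt_snd.sub (hasFDerivAt_fst.const_smul t)
  have h2 : HasFDerivAt (fun q : EuclideanSpace ℝ (Fin 3) × EuclideanSpace ℝ (Fin 3) =>
      u₀ (q.2 - t • q.1)) ((fderiv ℝ u₀ (x - t • y)).comp
        (ContinuousLinearMap.snd ℝ _ _ - t • ContinuousLinearMap.fst ℝ _ _)) (y, x) :=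
    ((hu₀.differentiable (by simp)) _).hasFDerivAt.comp (y, x) h2'
  have h3 : HasFDerivAt (fun q : EuclideanSpace ℝ (Fin 3) × EuclideanSpace ℝ (Fin 3) =>
      h q.1 • u₀ (q.2 - t • q.1))
      (h (y, x).1 • (fderiv ℝ u₀ (x - t • y)).comp
        (ContinuousLinearMap.snd ℝ _ _ - t • ContinuousLinearMap.fst ℝ _ _) +
        ((fderiv ℝ h y).comp (ContinuousLinearMap.fst ℝ _ _)).smulRight (u₀ ((y, x).2 - t • (y, x).1)))
      (y, x) := h1.smul h2
  rw [h3.fderiv]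
  ext v
  simp

/-- **The `x`-derivative of the dilated average** is the dilated average of `Du⁰`:
`D(u(t))(x) = ∫ h(y) Du⁰(x − ty) dy` (one derivative under the integral sign over the bounded set
`tsupport h`). [folklore] -/
private theorem fderiv_dilatedAverage (hu₀ : ContDiff ℝ ∞ u₀) (hh : IsUnitBump h) (t : ℝ)
    (x : EuclideanSpace ℝ (Fin 3)) :
    fderiv ℝ (dilatedAverage u₀ h t) x = ∫ y in tsupport h, h y • fderiv ℝ u₀ (x - t • y) := by
  have hK : Bornology.IsBounded (tsupport h) := hh.2.1.isCompact.isBounded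
  have hKm : MeasurableSet (tsupport h) := (isClosed_tsupport h).measurableSet
  have hfun : dilatedAverage u₀ h t = fun x => ∫ y in tsupport h,
      (fun q : EuclideanSpace ℝ (Fin 3) × EuclideanSpace ℝ (Fin 3) => h q.1 • u₀ (q.2 - t • q.1))
        (y, x) := funext (dilatedAverage_eq_setIntegral t)
  rw [hfun, (Literature.Analysis.FunctionSpaces.hasFDerivAt_parametric_setIntegral (μ := volume) hK hKm
    (contDiff_dilIntegrand_slice hu₀ hh.1 t) (by simp) x).fderiv]
  refine setIntegral_congr_fun hKm fun y _ => ?_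
  exact fderiv_dilIntegrand_slice_inr hu₀ hh.1 t y x

/-- The integrand of `fderiv_dilatedAverage` is integrable on `tsupport h` (continuous on a
bounded set). [folklore] -/
private theorem integrableOn_fderiv_dilIntegrand (hu₀ : ContDiff ℝ ∞ u₀) (hh : IsUnitBump h) (t : ℝ)
    (x : EuclideanSpace ℝ (Fin 3)) :
    IntegrableOn (fun y => h y • fderiv ℝ u₀ (x - t • y)) (tsupport h) volume := by
  have hc : Continuous fun y => h y • fderiv ℝ u₀ (x - t • y) :=
    hh.1.continuous.smul ((hu₀.continuous_fderiv (by simp)).comp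
      (continuous_const.sub (continuous_id.const_smul t)))
  exact Literature.Analysis.FunctionSpaces.integrableOn_of_continuous_of_isBounded hc hh.2.1.isCompact.isBounded

/-- **Step 3 holds** (l.140–151: «Let u(x,t) = ∫ u⁰(x − ty)h(y)dy. u(x,t) is C^∞ …, satisfies
u(x,0) = u⁰(x). Moreover, we have div u = 0 and curl u = 0»): joint smoothness by
differentiation under the integral sign over the bounded support of `h`
(`FunctionSpaces.contDiff_parametric_setIntegral`); `u(·,0) = u⁰ ∫h = u⁰`; and
`D(u(t))(x) = ∫ h(y) Du⁰(x − ty) dy` (`fderiv_dilatedAverage`), whose trace resp. curl is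
`∫ h(y) (div u⁰)(x − ty) dy = 0` resp. `∫ h(y) (curl u⁰)(x − ty) dy = 0` (the trace and
`curlCLM` commute with the Bochner integral). [cite: Lo2008, proof of Proposition 1, l.140–151 (p.2)] -/
theorem step_3_holds : Step_3 := by
  intro u₀ hu₀ hdiv hcurl h hh
  have hK : Bornology.IsBounded (tsupport h) := hh.2.1.isCompact.isBounded
  have hKm : MeasurableSet (tsupport h) := (isClosed_tsupport h).measurableSet
  refine ⟨?_, ?_, fun t => ⟨fun x => ?_, fun x => ?_⟩⟩
  · -- joint smoothness on `ℝ × ℝ³`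
    have hs := Literature.Analysis.FunctionSpaces.contDiff_parametric_setIntegral (μ := volume) hK hKm
      (contDiff_dilIntegrand hu₀ hh.1)
    have heq : uncurry (dilatedAverage u₀ h) = fun p : ℝ × EuclideanSpace ℝ (Fin 3) =>
        ∫ y in tsupport h, (fun q : EuclideanSpace ℝ (Fin 3) × (ℝ × EuclideanSpace ℝ (Fin 3)) =>
          h q.1 • u₀ (q.2.2 - q.2.1 • q.1)) (y, p) := by
      funext p
      exact dilatedAverage_eq_setIntegral p.1 p.2
    show ContDiffOn ℝ ∞ (uncurry (dilatedAverage u₀ h)) (univ ×ˢ univ)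
    rw [heq]
    exact hs.contDiffOn
  · -- initial value `u(·,0) = u⁰ ∫h = u⁰`
    funext x
    simp only [dilatedAverage, zero_smul, sub_zero]
    rw [integral_smul_const, hh.2.2, one_smul]
  · -- `div u(t) = 0`
    rw [divergence_eq_traceCLM, fderiv_dilatedAverage hu₀ hh t x,
      ← traceCLM.integral_comp_comm (integrableOn_fderiv_dilIntegrand hu₀ hh t x)]
    have h0 : ∀ y, traceCLM (h y • fderiv ℝ u₀ (x - t • y)) = 0 := fun y => by
      rw [map_smul, ← divergence_eq_traceCLM, hdiv (x - t • y), smul_zero]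
    simp [h0]
  · -- `curl u(t) = 0`
    rw [curl_eq_curlCLM, fderiv_dilatedAverage hu₀ hh t x,
      ← curlCLM.integral_comp_comm (integrableOn_fderiv_dilIntegrand hu₀ hh t x)]
    have h0 : ∀ y, curlCLM (h y • fderiv ℝ u₀ (x - t • y)) = 0 := fun y => by
      rw [map_smul, ← curl_eq_curlCLM, hcurl (x - t • y), smul_zero]
    simp [h0]

end Step3

end

end Literature.Claims.NS.Lo2008
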